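import Summits.AtomisticToContinuum.Crystallization.Theses.PalmUnimodularRigidity
import Summits.AtomisticToContinuum.Crystallization.Theorems.MinimiserShells.Negative.LoadBearing
import Summits.AtomisticToContinuum.Crystallization.Theorems.MinimiserShells.Negative.Rootedness
import Summits.AtomisticToContinuum.Crystallization.Theorems.PalmUnimodularRigidityMinimiserShellsEquilibriumInLawKernel
import Summits.AtomisticToContinuum.Crystallization.Theorems.PalmUnimodularRigidityMinimiserShellsEquilibriumInLawLattice
import Literature.Probability.Process.PointStationaryLaw
import Literature.MathematicalPhysics.StatisticalMechanics.RootEnergy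
import Literature.MathematicalPhysics.StatisticalMechanics.MuGSC

/-!
# The cell-average identity (Mecke + one uniform grid phase)

Helper file for stub `stub_equilibriumInLaw` (S1) of line `equilibrium-in-law-surgery`, crux
`MinimiserShells` (stmt-AtomisticToContinuum-9225): blueprint lemma 9, the one probabilistic
identity of the cluster-periodisation argument.

For a point-stationary law `P` a.s. carried by rooted hard-core configurations and a jointly
measurable `F : Measure E3 → E3 → ℝ≥0∞` that is `Lℤ³`-periodic in the phase,
`∫ cellAvg L F dP = ∫ (∫_{u ∈ [0,L)³} F(μ, u) du) dP(μ)` (`lintegral_cellAvg_eq`), where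
`cellAvg L F μ = ∫_{u ∈ [0,L)³} μ(cell_u)⁻¹ ∑_{y ∈ μ ∩ cell_u} F(θ_y μ, u − y) du` averages `F`
over the atoms of the root's grid cell, re-rooted.  Proof: Mecke with the transport
`g(μ, y) = ∫_{cube} 1[y ∈ cell_u] F(μ, u) μ(cell_u)⁻¹ du` ("the root sends `F(μ,u)/n_u` to every
atom of its cell"); on the receiving side `θ_{-y}θ_y μ = μ`, `1[−y ∈ cell_u] = 1[y ∈ cell_{u+y}]`,
`(θ_y μ)(cell_u) = μ(cell_{u+y})`, and the phase integral is shift-invariant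
(`setLIntegral_cube_add_right`).  All configuration-dependence is routed through the s-finite
kernel `lfKernel` (`reroot`, `cellAvg`), which makes the transport jointly measurable and
`cellAvg L F` a MEASURABLE function of `μ` (`measurable_cellAvg`).
-/

noncomputable section

open MeasureTheory ProbabilityTheory
open scoped ENNReal BigOperators

namespace Summit.AtomisticToContinuum.Crystallization.Theorems.PalmUnimodularRigidityMinimiserShells.EquilibriumInLaw.CellAverage

open Literature.Probability.Process (IsPointStationaryLaw IsRootedHardCore count_restrict_singleton_ne_zero_iff
  map_sub_count_restrict)
open Literature.MathematicalPhysics.StatisticalMechanics (lennardJones IsMuGSC UniformlyDiscrete)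
open Summit.AtomisticToContinuum.Crystallization.Theses.PalmUnimodularRigidity (MinimiserShells UnimodularEnergyLowerBound)
open Summit.AtomisticToContinuum.Crystallization.Theorems.MinimiserShells.Negative.LoadBearing
  (eStar meanRootEnergy GoodShell minimiserShells_iff)
open Summit.AtomisticToContinuum.Crystallization.Theorems.MinimiserShells.Negative.Rootedness (E3
  countable_of_separated)
open Summit.AtomisticToContinuum.Crystallization.Theorems.PalmUnimodularRigidityMinimiserShells.EquilibriumInLaw.LfKernel
  (lfKernel lfKernel_count_restrict lintegral_count_restrict)
open Summit.AtomisticToContinuum.Crystallization.Theorems.PalmUnimodularRigidityMinimiserShells.EquilibriumInLaw.Phase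
  (cube cell measurableSet_cube measurableSet_cell measurableSet_cellRel zero_mem_cell finite_inter_cell
  neg_mem_cell_iff preimage_sub_cell)
open Summit.AtomisticToContinuum.Crystallization.Theorems.PalmUnimodularRigidityMinimiserShells.EquilibriumInLaw.Lattice
  (latticeL cell_add_of_mem_latticeL setLIntegral_cube_add_right)

/-! ## Measurable re-rooting and cell masses through the kernel -/

/-- Re-rooting through the kernel: `reroot (μ, y) = (lfKernel μ).map (· − y)` (`= θ_y μ` on
locally finite `μ`), a MEASURABLE map `Measure E3 × E3 → Measure E3`. -/
def reroot (p : Measure E3 × E3) : Measure E3 := (lfKernel p.1).map fun z => z - p.2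

/-- Evaluation of `reroot`. -/
theorem reroot_apply (p : Measure E3 × E3) {s : Set E3} (hs : MeasurableSet s) :
    reroot p s = lfKernel p.1 {z | z - p.2 ∈ s} := by
  rw [reroot, Measure.map_apply (measurable_sub_const p.2) hs]
  rfl

/-- `reroot` is jointly measurable. -/
theorem measurable_reroot : Measurable reroot := by
  refine Measure.measurable_of_measurable_coe _ fun s hs => ?_
  have heq : (fun p : Measure E3 × E3 => reroot p s) = fun p => lfKernel p.1 {z | z - p.2 ∈ s} :=
    funext fun p => reroot_apply p hs
  rw [heq]
  have ht : MeasurableSet {q : (Measure E3 × E3) × E3 | q.2 - q.1.2 ∈ s} :=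
    hs.preimage (measurable_snd.sub (measurable_snd.comp measurable_fst))
  have h := Kernel.measurable_kernel_prodMk_left (κ := Kernel.prodMkRight E3 lfKernel) ht
  simpa only [Kernel.prodMkRight_apply, Set.preimage_setOf_eq] using h

/-- On a measure fixed by the kernel, `reroot` is the honest re-rooting. -/
theorem reroot_eq_map {μ : Measure E3} (hμ : lfKernel μ = μ) (y : E3) :
    reroot (μ, y) = μ.map fun z => z - y := by
  change (lfKernel μ).map _ = _
  rw [hμ]

/-- The cell mass `(μ, u) ↦ (lfKernel μ) (cell L u)` is jointly measurable. -/
theorem measurable_cellMass (L : ℝ) : Measurable fun p : Measure E3 × E3 => lfKernel p.1 (cell L p.2) := by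
  have ht : MeasurableSet {q : (Measure E3 × E3) × E3 | q.2 ∈ cell L q.1.2} :=
    (measurableSet_cellRel L).preimage ((measurable_snd.comp measurable_fst).prodMk measurable_snd)
  have h := Kernel.measurable_kernel_prodMk_left (κ := Kernel.prodMkRight E3 lfKernel) ht
  simpa only [Kernel.prodMkRight_apply, Set.preimage_setOf_eq, Set.setOf_mem_eq] using h

/-! ## The cell average functional -/

/-- **The cell average of `F` over the root's cell, re-rooted**:
`cellAvg L F μ = ∫_{u ∈ cube} (κμ (cell_u))⁻¹ · ∫_{y ∈ cell_u} F (reroot (μ, y)) (u − y) d(κμ)(y) du`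
with `κ = lfKernel` (so `κμ = μ` on hard-core configurations). -/
def cellAvg (L : ℝ) (F : Measure E3 → E3 → ℝ≥0∞) (μ : Measure E3) : ℝ≥0∞ :=
  ∫⁻ u in cube L, (lfKernel μ (cell L u))⁻¹ *
    ∫⁻ y, (cell L u).indicator (fun y => F (reroot (μ, y)) (u - y)) y ∂(lfKernel μ)

/-- The re-rooted integrand is jointly measurable in `((μ, u), y)`. -/
theorem measurable_integrand {L : ℝ} {F : Measure E3 → E3 → ℝ≥0∞} (hF : Measurable (Function.uncurry F)) :
    Measurable fun q : (Measure E3 × E3) × E3 =>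
      (cell L q.1.2).indicator (fun y => F (reroot (q.1.1, y)) (q.1.2 - y)) q.2 := by
  set T : Set ((Measure E3 × E3) × E3) := {q | q.2 ∈ cell L q.1.2} with hT
  have ht : MeasurableSet T :=
    (measurableSet_cellRel L).preimage ((measurable_snd.comp measurable_fst).prodMk measurable_snd)
  have hG : Measurable fun q : (Measure E3 × E3) × E3 => F (reroot (q.1.1, q.2)) (q.1.2 - q.2) :=
    hF.comp ((measurable_reroot.comp ((measurable_fst.comp measurable_fst).prodMk measurable_snd)).prodMk
      ((measurable_snd.comp measurable_fst).sub measurable_snd))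
  have heq : (fun q : (Measure E3 × E3) × E3 =>
      (cell L q.1.2).indicator (fun y => F (reroot (q.1.1, y)) (q.1.2 - y)) q.2) =
      T.indicator fun q => F (reroot (q.1.1, q.2)) (q.1.2 - q.2) := by
    funext q
    by_cases hq : q.2 ∈ cell L q.1.2
    · have hqT : q ∈ T := hq
      rw [Set.indicator_of_mem hq, Set.indicator_of_mem hqT]
    · have hqT : q ∉ T := hq
      rw [Set.indicator_of_notMem hq, Set.indicator_of_notMem hqT]
  rw [heq]
  exact hG.indicator ht

/-- The integrand of the cell average is jointly measurable in `(μ, u)`. -/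
theorem measurable_cellAvgIntegrand {L : ℝ} {F : Measure E3 → E3 → ℝ≥0∞} (hF : Measurable (Function.uncurry F)) :
    Measurable fun a : Measure E3 × E3 => (lfKernel a.1 (cell L a.2))⁻¹ *
      ∫⁻ y, (cell L a.2).indicator (fun y => F (reroot (a.1, y)) (a.2 - y)) y ∂(lfKernel a.1) := by
  have h1 : Measurable fun a : Measure E3 × E3 =>
      ∫⁻ y, (cell L a.2).indicator (fun y => F (reroot (a.1, y)) (a.2 - y)) y ∂(lfKernel a.1) :=
    (measurable_integrand hF).lintegral_kernel_prod_right' (κ := Kernel.prodMkRight E3 lfKernel)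
  exact (measurable_cellMass L).inv.mul h1

/-- **The cell average is a measurable function of the configuration.** -/
theorem measurable_cellAvg {L : ℝ} {F : Measure E3 → E3 → ℝ≥0∞} (hF : Measurable (Function.uncurry F)) :
    Measurable (cellAvg L F) :=
  (measurable_cellAvgIntegrand hF).lintegral_prod_right' (ν := volume.restrict (cube L))

/-! ## Counting measures: s-finiteness -/

/-- The counting measure of a countable set is σ-finite (singletons of `S` and `Sᶜ` cover). -/
theorem sigmaFinite_count_restrict {S : Set E3} (hS : S.Countable) :
    SigmaFinite ((Measure.count : Measure E3).restrict S) := by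
  refine Measure.sigmaFinite_of_countable (S := insert Sᶜ ((fun x => ({x} : Set E3)) '' S))
    ((hS.image _).insert _) ?_ ?_
  · rintro s (rfl | ⟨x, -, rfl⟩)
    · rw [Measure.restrict_apply hS.measurableSet.compl, Set.compl_inter_self, measure_empty]
      exact ENNReal.zero_lt_top
    · rw [Measure.restrict_apply (measurableSet_singleton x)]
      exact (measure_mono Set.inter_subset_left).trans_lt
        (by rw [Measure.count_singleton]; exact ENNReal.one_lt_top)
  · rw [Set.sUnion_insert, Set.sUnion_image]
    ext z
    simp only [Set.mem_union, Set.mem_compl_iff, Set.mem_iUnion, Set.mem_singleton_iff, Set.mem_univ,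
      iff_true]
    by_cases hz : z ∈ S
    · exact Or.inr ⟨z, hz, rfl⟩
    · exact Or.inl hz

/-- The counting measure of a countable set is s-finite. -/
theorem sFinite_count_restrict {S : Set E3} (hS : S.Countable) :
    SFinite ((Measure.count : Measure E3).restrict S) := by
  haveI := sigmaFinite_count_restrict hS
  infer_instance

/-! ## The identity -/

/-- The transport of the proof: the root sends `F(μ, u) / κμ(cell_u)` to every atom of its cell,
averaged over the phase. -/
def transport (L : ℝ) (F : Measure E3 → E3 → ℝ≥0∞) (μ : Measure E3) (y : E3) : ℝ≥0∞ :=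
  ∫⁻ u in cube L, (cell L u).indicator (fun _ : E3 => F μ u * (lfKernel μ (cell L u))⁻¹) y

/-- The transport is jointly measurable. -/
theorem measurable_transport {L : ℝ} {F : Measure E3 → E3 → ℝ≥0∞} (hF : Measurable (Function.uncurry F)) :
    Measurable (Function.uncurry (transport L F)) := by
  set T : Set ((Measure E3 × E3) × E3) := {q | q.1.2 ∈ cell L q.2} with hT
  have ht : MeasurableSet T :=
    (measurableSet_cellRel L).preimage (measurable_snd.prodMk (measurable_snd.comp measurable_fst))
  have hG : Measurable fun q : (Measure E3 × E3) × E3 => F q.1.1 q.2 * (lfKernel q.1.1 (cell L q.2))⁻¹ :=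
    (hF.comp ((measurable_fst.comp measurable_fst).prodMk measurable_snd)).mul
      ((measurable_cellMass L).comp ((measurable_fst.comp measurable_fst).prodMk measurable_snd)).inv
  have heq : (fun q : (Measure E3 × E3) × E3 =>
      (cell L q.2).indicator (fun _ : E3 => F q.1.1 q.2 * (lfKernel q.1.1 (cell L q.2))⁻¹) q.1.2) =
      T.indicator fun q => F q.1.1 q.2 * (lfKernel q.1.1 (cell L q.2))⁻¹ := by
    funext q
    by_cases hq : q.1.2 ∈ cell L q.2
    · have hqT : q ∈ T := hq
      rw [Set.indicator_of_mem hq, Set.indicator_of_mem hqT]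
    · have hqT : q ∉ T := hq
      rw [Set.indicator_of_notMem hq, Set.indicator_of_notMem hqT]
  have h : Measurable fun q : (Measure E3 × E3) × E3 =>
      (cell L q.2).indicator (fun _ : E3 => F q.1.1 q.2 * (lfKernel q.1.1 (cell L q.2))⁻¹) q.1.2 := by
    rw [heq]; exact hG.indicator ht
  exact h.lintegral_prod_right' (ν := volume.restrict (cube L))

/-- Mass sent by the root: `∑_{y ∈ μ} transport μ y = ∫_{cube} F(μ, u) du` for a rooted hard-core
configuration `μ`. -/
theorem lintegral_transport {L δ : ℝ} (hL : 0 < L) (hδ : 0 < δ) {F : Measure E3 → E3 → ℝ≥0∞}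
    (hF : Measurable (Function.uncurry F)) {μ : Measure E3} (hμ : IsRootedHardCore δ μ) :
    ∫⁻ y, transport L F μ y ∂μ = ∫⁻ u in cube L, F μ u := by
  obtain ⟨S, h0, hsep, rfl⟩ := hμ
  have hS : S.Countable := countable_of_separated hδ hsep
  haveI := sFinite_count_restrict hS
  have hκ := lfKernel_count_restrict hδ hsep
  -- swap the two integrals
  have hmeas : Measurable (Function.uncurry fun (y : E3) (u : E3) =>
      (cell L u).indicator (fun _ : E3 => F ((Measure.count : Measure E3).restrict S) u *
        (lfKernel ((Measure.count : Measure E3).restrict S) (cell L u))⁻¹) y) := by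
    -- the joint measurability of the integrand at the fixed configuration
    set T : Set (E3 × E3) := {q | q.1 ∈ cell L q.2} with hT
    have ht : MeasurableSet T :=
      (measurableSet_cellRel L).preimage (measurable_snd.prodMk measurable_fst)
    have hG : Measurable fun q : E3 × E3 => F ((Measure.count : Measure E3).restrict S) q.2 *
        (lfKernel ((Measure.count : Measure E3).restrict S) (cell L q.2))⁻¹ :=
      ((hF.comp (measurable_const.prodMk measurable_snd)).mul
        ((measurable_cellMass L).comp (measurable_const.prodMk measurable_snd)).inv)
    have heq : (Function.uncurry fun (y : E3) (u : E3) =>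
        (cell L u).indicator (fun _ : E3 => F ((Measure.count : Measure E3).restrict S) u *
          (lfKernel ((Measure.count : Measure E3).restrict S) (cell L u))⁻¹) y) =
        T.indicator fun q =>
          F ((Measure.count : Measure E3).restrict S) q.2 *
            (lfKernel ((Measure.count : Measure E3).restrict S) (cell L q.2))⁻¹ := by
      funext q
      obtain ⟨y, u⟩ := q
      simp only [Function.uncurry_apply_pair]
      by_cases hq : y ∈ cell L u
      · have hqT : (y, u) ∈ T := hq
        rw [Set.indicator_of_mem hq, Set.indicator_of_mem hqT]
      · have hqT : (y, u) ∉ T := hq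
        rw [Set.indicator_of_notMem hq, Set.indicator_of_notMem hqT]
    rw [heq]
    exact hG.indicator ht
  unfold transport
  rw [lintegral_lintegral_swap hmeas.aemeasurable]
  refine setLIntegral_congr_fun (measurableSet_cube L) fun u _ => ?_
  rw [lintegral_indicator_const (measurableSet_cell L u), hκ]
  -- `n_u := count (S ∩ cell u) ∈ (0, ∞)`
  have hfin : (S ∩ cell L u).Finite := finite_inter_cell hL hδ hsep u
  have hne : (Measure.count : Measure E3).restrict S (cell L u) ≠ 0 := fun h =>
    (count_restrict_singleton_ne_zero_iff S 0).2 h0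
      (measure_mono_null (Set.singleton_subset_iff.2 (zero_mem_cell L u)) h)
  have htop : (Measure.count : Measure E3).restrict S (cell L u) ≠ ∞ := by
    rw [Measure.restrict_apply (measurableSet_cell L u), Set.inter_comm, Measure.count_apply_finite _ hfin]
    exact ENNReal.natCast_ne_top _
  rw [mul_assoc, ENNReal.inv_mul_cancel hne htop, mul_one]

/-- Mass received by the root: `∑_{y ∈ μ} transport (θ_y μ) (−y) = cellAvg L F μ` for a rooted
hard-core configuration `μ` (the shift lemma moves the phase). -/
theorem lintegral_transport_reroot {L δ : ℝ} (hL : 0 < L) (hδ : 0 < δ) {F : Measure E3 → E3 → ℝ≥0∞}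
    (hF : Measurable (Function.uncurry F)) (hper : ∀ μ, ∀ v ∈ latticeL hL.ne', ∀ u, F μ (u + v) = F μ u)
    {μ : Measure E3} (hμ : IsRootedHardCore δ μ) :
    ∫⁻ y, transport L F (μ.map fun z => z - y) (-y) ∂μ = cellAvg L F μ := by
  obtain ⟨S, h0, hsep, rfl⟩ := hμ
  have hS : S.Countable := countable_of_separated hδ hsep
  haveI := sFinite_count_restrict hS
  have hκ := lfKernel_count_restrict hδ hsep
  -- the received integrand, as a function of (atom, phase)
  set I : E3 → E3 → ℝ≥0∞ := fun y u => (cell L u).indicator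
    (fun y => F (reroot ((Measure.count : Measure E3).restrict S, y)) (u - y) *
      ((Measure.count : Measure E3).restrict S (cell L u))⁻¹) y with hI
  -- Step 1: pointwise in `y ∈ S`, rewrite the transport received from `y`
  have step1 : ∀ y ∈ S,
      transport L F (((Measure.count : Measure E3).restrict S).map fun z => z - y) (-y) =
        ∫⁻ u in cube L, I y u := by
    intro y hy
    -- the re-rooted configuration is again a separated counting measure
    have hmap : ((Measure.count : Measure E3).restrict S).map (fun z => z - y) =
        (Measure.count : Measure E3).restrict ((fun z => z - y) '' S) :=
      map_sub_count_restrict S y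
    have hsep' : ∀ x ∈ (fun z => z - y) '' S, ∀ x' ∈ (fun z => z - y) '' S, x ≠ x' → δ ≤ dist x x' := by
      rintro _ ⟨a, ha, rfl⟩ _ ⟨b, hb, rfl⟩ hne
      rw [dist_sub_right]
      exact hsep a ha b hb fun h => hne (by rw [h])
    have hκ' : lfKernel (((Measure.count : Measure E3).restrict S).map fun z => z - y) =
        ((Measure.count : Measure E3).restrict S).map fun z => z - y := by
      rw [hmap]; exact lfKernel_count_restrict hδ hsep'
    have hrr : reroot ((Measure.count : Measure E3).restrict S, y) =
        ((Measure.count : Measure E3).restrict S).map fun z => z - y := reroot_eq_map hκ y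
    -- the integrand is the shift of the periodic function `I y`
    have hIper : ∀ v ∈ latticeL hL.ne', ∀ w, I y (w + v) = I y w := by
      intro v hv w
      simp only [hI, cell_add_of_mem_latticeL hL.ne' hv, add_sub_right_comm, hper _ v hv]
    have hshift : ∀ u, (cell L u).indicator (fun _ : E3 =>
        F (((Measure.count : Measure E3).restrict S).map fun z => z - y) u *
          (lfKernel (((Measure.count : Measure E3).restrict S).map fun z => z - y) (cell L u))⁻¹) (-y) =
        I y (u + y) := by
      intro u
      simp only [hI, hκ']
      by_cases h : -y ∈ cell L u
      · have h' : y ∈ cell L (u + y) := (neg_mem_cell_iff L u y).1 h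
        rw [Set.indicator_of_mem h, Set.indicator_of_mem h', hrr, add_sub_cancel_right,
          Measure.map_apply (measurable_sub_const y) (measurableSet_cell L u), preimage_sub_cell L h']
      · have h' : y ∉ cell L (u + y) := fun h' => h ((neg_mem_cell_iff L u y).2 h')
        rw [Set.indicator_of_notMem h, Set.indicator_of_notMem h']
    unfold transport
    simp_rw [hshift]
    exact setLIntegral_cube_add_right hL hIper y
  -- Step 2: integrate over the atoms and swap
  have hmeasI : Measurable (Function.uncurry I) := by
    set T : Set (E3 × E3) := {q | q.1 ∈ cell L q.2} with hT
    have ht : MeasurableSet T :=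
      (measurableSet_cellRel L).preimage (measurable_snd.prodMk measurable_fst)
    have hm : Measurable fun q : E3 × E3 => (Measure.count : Measure E3).restrict S (cell L q.2) := by
      have := (measurable_cellMass L).comp (measurable_const.prodMk measurable_snd :
        Measurable fun q : E3 × E3 => ((Measure.count : Measure E3).restrict S, q.2))
      simpa only [Function.comp_def, hκ] using this
    have hG : Measurable fun q : E3 × E3 =>
        F (reroot ((Measure.count : Measure E3).restrict S, q.1)) (q.2 - q.1) *
          ((Measure.count : Measure E3).restrict S (cell L q.2))⁻¹ :=
      (hF.comp ((measurable_reroot.comp (measurable_const.prodMk measurable_fst)).prodMk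
        (measurable_snd.sub measurable_fst))).mul hm.inv
    have heq : Function.uncurry I = T.indicator fun q =>
        F (reroot ((Measure.count : Measure E3).restrict S, q.1)) (q.2 - q.1) *
          ((Measure.count : Measure E3).restrict S (cell L q.2))⁻¹ := by
      funext q
      obtain ⟨y, u⟩ := q
      simp only [Function.uncurry_apply_pair, hI]
      by_cases hq : y ∈ cell L u
      · have hqT : (y, u) ∈ T := hq
        rw [Set.indicator_of_mem hq, Set.indicator_of_mem hqT]
      · have hqT : (y, u) ∉ T := hq
        rw [Set.indicator_of_notMem hq, Set.indicator_of_notMem hqT]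
    rw [heq]
    exact hG.indicator ht
  calc ∫⁻ y, transport L F (((Measure.count : Measure E3).restrict S).map fun z => z - y) (-y)
        ∂(Measure.count : Measure E3).restrict S
      = ∫⁻ y, (∫⁻ u in cube L, I y u) ∂(Measure.count : Measure E3).restrict S :=
        setLIntegral_congr_fun (μ := (Measure.count : Measure E3)) hS.measurableSet fun y hy => step1 y hy
    _ = ∫⁻ u in cube L, (∫⁻ y, I y u ∂(Measure.count : Measure E3).restrict S) :=
        lintegral_lintegral_swap (μ := (Measure.count : Measure E3).restrict S)
          (ν := volume.restrict (cube L)) hmeasI.aemeasurable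
    _ = cellAvg L F ((Measure.count : Measure E3).restrict S) := by
        unfold cellAvg
        rw [hκ]
        refine setLIntegral_congr_fun (μ := (volume : Measure E3)) (measurableSet_cube L) fun u _ => ?_
        have hne : (Measure.count : Measure E3).restrict S (cell L u) ≠ 0 := fun h =>
          (count_restrict_singleton_ne_zero_iff S 0).2 h0 (measure_mono_null
            (Set.singleton_subset_iff.2 (zero_mem_cell L u)) h)
        have hinv : ((Measure.count : Measure E3).restrict S (cell L u))⁻¹ ≠ ∞ := ENNReal.inv_ne_top.2 hne
        calc ∫⁻ y, I y u ∂(Measure.count : Measure E3).restrict S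
            = ∫⁻ y, (cell L u).indicator
                (fun y => F (reroot ((Measure.count : Measure E3).restrict S, y)) (u - y)) y *
                ((Measure.count : Measure E3).restrict S (cell L u))⁻¹ ∂(Measure.count : Measure E3).restrict S := by
              refine lintegral_congr fun y => ?_
              simp only [hI]
              by_cases hy : y ∈ cell L u
              · rw [Set.indicator_of_mem hy, Set.indicator_of_mem hy]
              · rw [Set.indicator_of_notMem hy, Set.indicator_of_notMem hy, zero_mul]
          _ = (∫⁻ y, (cell L u).indicator
                (fun y => F (reroot ((Measure.count : Measure E3).restrict S, y)) (u - y)) y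
                ∂(Measure.count : Measure E3).restrict S) *
                ((Measure.count : Measure E3).restrict S (cell L u))⁻¹ := lintegral_mul_const' _ _ hinv
          _ = _ := mul_comm _ _

/-- **The cell-average identity.**  For `L > 0`, a point-stationary law `P` almost surely carried
by rooted `δ`-hard-core configurations, and a jointly measurable `F : Measure E3 → E3 → ℝ≥0∞` that
is `Lℤ³`-periodic in the phase:
`∫ cellAvg L F dP = ∫ (∫_{u ∈ [0, L)³} F(μ, u) du) dP(μ)`. -/
theorem lintegral_cellAvg_eq {L δ : ℝ} (hL : 0 < L) (hδ : 0 < δ) {P : Measure (Measure E3)}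
    (hcore : ∀ᵐ μ ∂P, IsRootedHardCore δ μ) (hstat : IsPointStationaryLaw P)
    {F : Measure E3 → E3 → ℝ≥0∞} (hF : Measurable (Function.uncurry F))
    (hper : ∀ μ, ∀ v ∈ latticeL hL.ne', ∀ u, F μ (u + v) = F μ u) :
    ∫⁻ μ, cellAvg L F μ ∂P = ∫⁻ μ, (∫⁻ u in cube L, F μ u) ∂P := by
  have hM := hstat (transport L F) (measurable_transport hF)
  calc ∫⁻ μ, cellAvg L F μ ∂P = ∫⁻ μ, (∫⁻ y, transport L F (μ.map fun z => z - y) (-y) ∂μ) ∂P :=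
        lintegral_congr_ae (hcore.mono fun μ hμ => (lintegral_transport_reroot hL hδ hF hper hμ).symm)
    _ = ∫⁻ μ, (∫⁻ y, transport L F μ y ∂μ) ∂P := hM.symm
    _ = ∫⁻ μ, (∫⁻ u in cube L, F μ u) ∂P :=
        lintegral_congr_ae (hcore.mono fun μ hμ => lintegral_transport hL hδ hF hμ)

/-- Registered stub marker (helper part 10/14 of `stub_equilibriumInLaw`, line `equilibrium-in-law-surgery`):
the cell-average identity `lintegral_cellAvg_eq`, closed form. -/
theorem stub_equilibriumInLaw_part10 :
    ∀ (L δ : ℝ) (hL : 0 < L), 0 < δ → ∀ (P : Measure (Measure (EuclideanSpace ℝ (Fin 3)))),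
      (∀ᵐ μ ∂P, IsRootedHardCore δ μ) → IsPointStationaryLaw P →
      ∀ (F : Measure (EuclideanSpace ℝ (Fin 3)) → EuclideanSpace ℝ (Fin 3) → ℝ≥0∞), Measurable (Function.uncurry F) →
      (∀ μ, ∀ v ∈ latticeL hL.ne', ∀ u, F μ (u + v) = F μ u) →
      ∫⁻ μ, cellAvg L F μ ∂P = ∫⁻ μ, (∫⁻ u in cube L, F μ u) ∂P :=
  fun _ _ hL hδ _ hcore hstat _ hF hper => lintegral_cellAvg_eq hL hδ hcore hstat hF hper

end Summit.AtomisticToContinuum.Crystallization.Theorems.PalmUnimodularRigidityMinimiserShells.EquilibriumInLaw.CellAverage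

end
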